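import Literature.NumberTheory.EllipticCurves.HeegnerPointsKolyvaginPrimaryLeavesProofs
import Literature.NumberTheory.EllipticCurves.HeegnerPointsKolyvaginPrimaryNoTorsionProofs
import HarnessLib

/-!
# `E(K)/p^M E(K) = ℤ x₀` from Kolyvagin's annihilation, without Mordell–Weil

Topic `NumberTheory/EllipticCurves`; namespace `Literature.NumberTheory.EllipticCurves`. Theorems only:
**no definition and no named fact is introduced** (D-0026). Sibling of
`HeegnerPointsKolyvaginPrimaryLeavesProofs`.

In the proof of McCallum 1991, Thm. 5.4 (PDF p. 288) the Cassels–Tate pairing of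
`Ш(E/K)_{p^M} = S_{p^M}(E/K)/(E(K)/p^M)` is non-degenerate, and `E(K)/p^M = ℤ x₀` because `E(K)` has
rank one (Kolyvagin) and no `p`-torsion. For the order bound over the descent data
(`HeegnerPointsKolyvaginPrimaryOrderProofs.card_quotient_le_of_casselsTate`, hypothesis `hnd`:
*"`P(z, ·) = 0 ⟹ z ∈ ℤx`"*) the kernel of the pulled-back pairing is `ker(Sel → H¹(K, E))`
(`CasselsTateSelmerPullback.forall_pullback_eq_zero_iff`), i.e. the image of the Kummer map
`E(K)/p^M E(K)`; this file shows that this image IS `ℤx`, `x = δ_M x₀`, using ONLY Kolyvagin's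
annihilation in the form it enters the order bound (`hkill`: `p^{M₀} · Sel ⊆ ℤx`, McCallum Thm. 4.5 /
Gross Prop. 10.5 at level `M`; the (P2-KOLYC) chain), `M ≥ 2M₀`, `ord x = p^M` and `E(K)[p] = 0`
— no Mordell–Weil, no rank statement:

* `KolyvaginDescent.kummerMapTorsion_mem_zmultiples_of_kill` — every Kummer class `δ_M Q`,
  `Q ∈ E(K)`, lies in `ℤ x`: `p^{M₀} δQ = k x` with `p^{M₀} ∣ k` (as `p^M δQ = 0` and `ord x = p^M`),
  so `p^{M₀}(Q − a x₀) ∈ p^M E(K)`, whence `Q − a x₀ ∈ p^{M−M₀} E(K)` (no `p`-torsion) and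
  `δQ − a x ∈ p^{M−M₀} δ(E(K)) ⊆ p^{M₀} Sel ⊆ ℤx`;
* `KolyvaginDescent.mem_zmultiples_of_torsionH1ToH1_eq_zero` — hence every `z ∈ H¹(K, E[p^M])`
  dying in `H¹(K, E)` lies in `ℤx` (exactness of the Kummer sequence,
  `mem_range_kummerMapTorsion_of_torsionH1ToH1_eq_zero`).

## References

* [McCallumLMS1991] W. G. McCallum, *Kolyvagin's work on Shafarevich–Tate groups* (1991), Thm. 4.5,
  §5 Lemma 5.1, Thm. 5.4 (proof).
* [GrossLMS1991] B. H. Gross, *Kolyvagin's work on modular elliptic curves* (1991), Prop. 10.5,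
  Lemma 4.3.
* [SilvermanAEC2009] J. H. Silverman, *The Arithmetic of Elliptic Curves* (2009), VIII.§2.
-/

noncomputable section

open scoped Classical

universe u

namespace Literature.NumberTheory.EllipticCurves

namespace KolyvaginDescent

open _root_.WeierstrassCurve Field NumberField
open Literature.NumberTheory.GaloisRepresentations

variable (W : WeierstrassCurve ℚ) {K : Type u} [Field K] [NumberField K]

/-- **Every Kummer class lies in `ℤx` under Kolyvagin's annihilation.** Setting: `E = W/ℚ`
elliptic, `K` imaginary quadratic, `p` odd with `ρ̄_{E,p}` onto (so `E(K)[p] = 0`), `x = δ_M x₀` of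
order `p^M` (`p^{M-1} x ≠ 0`), `2M₀ ≤ M`, and `p^{M₀} s ∈ ℤx` for every `s ∈ S_{p^M}(E/K)`
(Kolyvagin's annihilation as used in McCallum's Thm. 5.4). Then `δ_M Q ∈ ℤx` for every `Q ∈ E(K)`.
[cite: McCallumLMS1991, Thm. 5.4 (proof), Lemma 5.1] [cite: GrossLMS1991, Prop. 10.5] -/
theorem kummerMapTorsion_mem_zmultiples_of_kill [W.IsElliptic] (hK : IsImaginaryQuadratic K)
    {p : ℕ} (hp : p.Prime) (hp2 : p ≠ 2) (hρ : W.HasSurjectiveModNGaloisRep p) {M M₀ : ℕ}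
    (hM : 2 * M₀ ≤ M) (hdiv : ∀ Q : geomPoints (W.baseChange K), ∃ R, ((p ^ M : ℕ) : ℤ) • R = Q)
    (x₀ : (W.baseChange K).toAffine.Point)
    (hxord : ((p : ℤ) ^ (M - 1)) • kummerMapTorsion (W.baseChange K) _ hdiv x₀ ≠ 0)
    (hkill : ∀ s ∈ selmerGroup (W.baseChange K) ((p ^ M : ℕ) : ℤ),
      ((p : ℤ) ^ M₀) • s ∈ AddSubgroup.zmultiples (kummerMapTorsion (W.baseChange K) _ hdiv x₀))
    (Q : (W.baseChange K).toAffine.Point) :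
    kummerMapTorsion (W.baseChange K) _ hdiv Q ∈
      AddSubgroup.zmultiples (kummerMapTorsion (W.baseChange K) _ hdiv x₀) := by
  set δ := kummerMapTorsion (W.baseChange K) ((p ^ M : ℕ) : ℤ) hdiv with hδ
  have hM₀ : M₀ ≤ M := by omega
  -- `E(K)` has no `p^{M₀}`-torsion
  have hbot := torsionBy_pow_eq_bot (torsionBy_eq_bot_of_isImaginaryQuadratic W K hK hp hp2 hρ) M₀
  -- `p^M` kills `V`, `x` has order `p^M`
  have htor : ∀ v : galH1Torsion (W.baseChange K) ((p ^ M : ℕ) : ℤ), ((p : ℤ) ^ M) • v = 0 := fun v => by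
    have := zsmul_discreteH1_torsion ((p ^ M : ℕ) : ℤ) v
    exact_mod_cast this
  have hδSel : ∀ R : (W.baseChange K).toAffine.Point, δ R ∈ selmerGroup (W.baseChange K) ((p ^ M : ℕ) : ℤ) :=
    fun R => (mem_selmerGroup_iff _ _ _).mpr
      ⟨fun _ ↦ kummerMapTorsion_mem_selmerLocalKer _ _ _ _ R,
        fun _ ↦ kummerMapTorsion_mem_selmerLocalKer _ _ _ _ R⟩
  -- `p^{M₀} δQ = k x` with `p^{M₀} ∣ k`
  obtain ⟨k, hk⟩ := AddSubgroup.mem_zmultiples_iff.mp (hkill (δ Q) (hδSel Q))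
  have hkx : ((p : ℤ) ^ (M - M₀) * k) • δ x₀ = 0 := by
    rw [mul_zsmul, hk, ← mul_zsmul, ← pow_add, Nat.sub_add_cancel hM₀]
    exact htor _
  obtain ⟨a, ha⟩ : ((p : ℤ) ^ M₀) ∣ k := by
    have h := (zsmul_eq_zero_iff_prime_pow_dvd hp (htor (δ x₀)) hxord _).mp hkx
    have hsplit : ((p : ℤ) ^ M) = (p : ℤ) ^ (M - M₀) * (p : ℤ) ^ M₀ := by
      rw [← pow_add, Nat.sub_add_cancel hM₀]
    rw [hsplit] at h
    exact (mul_dvd_mul_iff_left (pow_ne_zero _ (by exact_mod_cast hp.ne_zero))).mp h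
  -- `δ(p^{M₀}(Q - a x₀)) = 0`, so `p^{M₀}(Q - a x₀) = p^M R`
  have hcast : ((p ^ M₀ : ℕ) : ℤ) = (p : ℤ) ^ M₀ := by push_cast; rfl
  have hker : p ^ M₀ • (Q - a • x₀) ∈ (δ).ker := by
    rw [AddMonoidHom.mem_ker, map_nsmul, ← natCast_zsmul, hcast, map_sub, map_zsmul, zsmul_sub, ← hk, ha,
      smul_smul, sub_self]
  rw [hδ, kummerMapTorsion_ker] at hker
  obtain ⟨R, hR⟩ := hker
  -- no `p^{M₀}`-torsion: `Q - a x₀ = p^{M - M₀} R`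
  have hQ : Q - a • x₀ = ((p : ℤ) ^ (M - M₀)) • R := by
    have h0 : p ^ M₀ • (Q - a • x₀ - ((p : ℤ) ^ (M - M₀)) • R) = 0 := by
      have hpM : ((p ^ M : ℕ) : ℤ) = ((p ^ M₀ : ℕ) : ℤ) * (p : ℤ) ^ (M - M₀) := by
        rw [hcast, ← pow_add, Nat.add_sub_cancel' hM₀]
        push_cast
        rfl
      have hR' : (((p ^ M₀ : ℕ) : ℤ) * (p : ℤ) ^ (M - M₀)) • R = p ^ M₀ • (Q - a • x₀) := by
        rw [← hpM]
        exact hR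
      rw [nsmul_sub, ← hR', mul_zsmul, natCast_zsmul, sub_self]
    have hmem : Q - a • x₀ - ((p : ℤ) ^ (M - M₀)) • R ∈
        AddSubgroup.torsionBy (W.baseChange K).toAffine.Point ((p ^ M₀ : ℕ) : ℤ) := by
      rw [AddSubgroup.torsionBy, Submodule.mem_toAddSubgroup, Submodule.mem_torsionBy_iff]
      rw [natCast_zsmul]
      exact h0
    rw [hbot] at hmem
    exact sub_eq_zero.mp hmem
  -- `δQ = a x + p^{M-M₀} δR`, and `p^{M-M₀} δR ∈ ℤx` since `M - M₀ ≥ M₀`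
  have hQ' : Q = a • x₀ + ((p : ℤ) ^ (M - M₀)) • R := by rw [← hQ]; abel
  rw [hQ', map_add, map_zsmul, map_zsmul]
  refine add_mem (AddSubgroup.zsmul_mem _ (AddSubgroup.mem_zmultiples _) a) ?_
  exact pow_zsmul_mem_of_le (by omega) (hkill (δ R) (hδSel R))

/-- **`ker(H¹(K, E[p^M]) → H¹(K, E)) ⊆ ℤx` under Kolyvagin's annihilation** (the input `hnd` of the
order bound, with `CasselsTateSelmerPullback.forall_pullback_eq_zero_iff`): a class dying in
`H¹(K, E)` is a Kummer class (`mem_range_kummerMapTorsion_of_torsionH1ToH1_eq_zero`), hence in `ℤx`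
(`kummerMapTorsion_mem_zmultiples_of_kill`). [cite: McCallumLMS1991, Thm. 5.4 (proof), Lemma 5.1]
[cite: SilvermanAEC2009, VIII.§2] -/
theorem mem_zmultiples_of_torsionH1ToH1_eq_zero [W.IsElliptic] (hK : IsImaginaryQuadratic K)
    {p : ℕ} (hp : p.Prime) (hp2 : p ≠ 2) (hρ : W.HasSurjectiveModNGaloisRep p) {M M₀ : ℕ}
    (hM : 2 * M₀ ≤ M) (hdiv : ∀ Q : geomPoints (W.baseChange K), ∃ R, ((p ^ M : ℕ) : ℤ) • R = Q)
    (x₀ : (W.baseChange K).toAffine.Point)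
    (hxord : ((p : ℤ) ^ (M - 1)) • kummerMapTorsion (W.baseChange K) _ hdiv x₀ ≠ 0)
    (hkill : ∀ s ∈ selmerGroup (W.baseChange K) ((p ^ M : ℕ) : ℤ),
      ((p : ℤ) ^ M₀) • s ∈ AddSubgroup.zmultiples (kummerMapTorsion (W.baseChange K) _ hdiv x₀))
    {z : galH1Torsion (W.baseChange K) ((p ^ M : ℕ) : ℤ)}
    (hz : torsionH1ToH1 (W.baseChange K) ((p ^ M : ℕ) : ℤ) z = 0) :
    z ∈ AddSubgroup.zmultiples (kummerMapTorsion (W.baseChange K) _ hdiv x₀) := by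
  obtain ⟨Q, rfl⟩ := mem_range_kummerMapTorsion_of_torsionH1ToH1_eq_zero (W.baseChange K) _ hdiv z hz
  exact kummerMapTorsion_mem_zmultiples_of_kill W hK hp hp2 hρ hM hdiv x₀ hxord hkill Q

/-- **The same at a level written `n = p^M`** (for consumers at a level presented as `m · m`;
proof: `subst`). [cite: McCallumLMS1991, Thm. 5.4 (proof), Lemma 5.1] -/
theorem mem_zmultiples_of_torsionH1ToH1_eq_zero_level [W.IsElliptic] (hK : IsImaginaryQuadratic K)
    {p : ℕ} (hp : p.Prime) (hp2 : p ≠ 2) (hρ : W.HasSurjectiveModNGaloisRep p) {M M₀ n : ℕ}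
    (hn : n = p ^ M) (hM : 2 * M₀ ≤ M)
    (hdiv : ∀ Q : geomPoints (W.baseChange K), ∃ R, (n : ℤ) • R = Q)
    (x₀ : (W.baseChange K).toAffine.Point)
    (hxord : ((p : ℤ) ^ (M - 1)) • kummerMapTorsion (W.baseChange K) _ hdiv x₀ ≠ 0)
    (hkill : ∀ s ∈ selmerGroup (W.baseChange K) (n : ℤ),
      ((p : ℤ) ^ M₀) • s ∈ AddSubgroup.zmultiples (kummerMapTorsion (W.baseChange K) _ hdiv x₀))
    {z : galH1Torsion (W.baseChange K) (n : ℤ)}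
    (hz : torsionH1ToH1 (W.baseChange K) (n : ℤ) z = 0) :
    z ∈ AddSubgroup.zmultiples (kummerMapTorsion (W.baseChange K) _ hdiv x₀) := by
  subst hn
  exact mem_zmultiples_of_torsionH1ToH1_eq_zero W hK hp hp2 hρ hM hdiv x₀ hxord hkill hz

end KolyvaginDescent

end Literature.NumberTheory.EllipticCurves

end
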